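import Mathlib
import HarnessLib

/-!
# Log-scale Gaussian layers, I: an Euler–Maclaurin engine (route EtaLeadingQuarter, item
`WeakLockingLayer`, stmt-RiemannHypothesis-21792)

Helper estimates (all proved, RH-free, no number theory) for the Dirichlet polynomials
`∑_{2 ≤ m ≤ M} g(log m − n) m^{iγ}` with the log-scale Gaussian profile `g(v) = exp(−v²/(2s²))`:

* `gaussPhase` — the entire function `G(u) = exp(iγu − (u − n)²/(2s²))`, so that
  `G(log m) = g(log m − n) · m^{iγ}` (`gaussPhase_log_natCast`);
* first-order Euler–Maclaurin on `[1, M]` (`norm_sum_sub_integral_le`):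
  `‖∑_{m=2}^{M} F(m) − ∫_1^M F‖ ≤ ∫_1^M ‖F'‖` for `F ∈ C¹[1, ∞)`;
* for `F(x) = G(log x)`: `∫_1^M ‖F'‖ = ∫_0^{log M} ‖G φ'‖ ≤ |γ| √(2π s²) + 2√π`
  (`integral_norm_deriv_eq`, `integral_norm_deriv_le`).

The main term (a truncated complex Gaussian integral) and the assembled two-sided estimate are in
part II, `EtaLeadingQuarterWeakLockingLayerGauss.lean`. These are the analytic inputs of the
locking-layer construction (BRIEF-L18 §1–§3, regime (R1)). Nothing here bears on the truth of RH.
-/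

noncomputable section

open Complex MeasureTheory Set Filter Finset intervalIntegral
open scoped Real Topology

set_option linter.dupNamespace false  -- the mandated namespace repeats `RiemannHypothesis`

namespace Summit.RiemannHypothesis.RiemannHypothesis.Theorems.EtaLeadingQuarter.LockingEngine

/-! ## The phase function -/

/-- The exponent `φ(u) = iγu − (u − n)²/(2s²)`. [folklore] -/
def phaseExp (s n γ u : ℝ) : ℂ := ((γ * u : ℝ) : ℂ) * I - (((u - n) ^ 2 / (2 * s ^ 2) : ℝ) : ℂ)

/-- Its derivative `φ'(u) = iγ − (u − n)/s²`. [folklore] -/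
def phaseExpDeriv (s n γ u : ℝ) : ℂ := ((γ : ℝ) : ℂ) * I - (((u - n) / s ^ 2 : ℝ) : ℂ)

/-- `G(u) = exp(φ(u))`, an entire function of the real variable `u`. [folklore] -/
def gaussPhase (s n γ u : ℝ) : ℂ := cexp (phaseExp s n γ u)

/-- `φ' ` is the derivative of `φ`. [folklore] -/
theorem hasDerivAt_phaseExp (s n γ u : ℝ) :
    HasDerivAt (phaseExp s n γ) (phaseExpDeriv s n γ u) u := by
  have h1 : HasDerivAt (fun u : ℝ => γ * u) γ u := by
    simpa using (hasDerivAt_id u).const_mul γ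
  have h2 : HasDerivAt (fun u : ℝ => (u - n) ^ 2 / (2 * s ^ 2)) ((u - n) / s ^ 2) u := by
    have h := (((hasDerivAt_id u).sub_const n).pow 2).div_const (2 * s ^ 2)
    refine h.congr_deriv ?_
    simp only [id_eq, Nat.cast_ofNat]
    ring
  have h3 := (h1.ofReal_comp.mul_const I).sub h2.ofReal_comp
  exact h3

/-- `G' = G · φ'`. [folklore] -/
theorem hasDerivAt_gaussPhase (s n γ u : ℝ) :
    HasDerivAt (gaussPhase s n γ) (gaussPhase s n γ u * phaseExpDeriv s n γ u) u := by
  unfold gaussPhase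
  exact (hasDerivAt_phaseExp s n γ u).cexp

/-- `Re φ(u) = −(u − n)²/(2s²)`. [folklore] -/
theorem re_phaseExp (s n γ u : ℝ) : (phaseExp s n γ u).re = -((u - n) ^ 2 / (2 * s ^ 2)) := by
  simp only [phaseExp, Complex.sub_re, Complex.mul_re, Complex.ofReal_re, Complex.ofReal_im,
    Complex.I_re, Complex.I_im]
  ring

/-- `‖G(u)‖ = g(u − n) = exp(−(u − n)²/(2s²))`. [folklore] -/
theorem norm_gaussPhase (s n γ u : ℝ) :
    ‖gaussPhase s n γ u‖ = Real.exp (-((u - n) ^ 2 / (2 * s ^ 2))) := by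
  rw [gaussPhase, Complex.norm_exp, re_phaseExp]

/-- `‖φ'(u)‖ ≤ |γ| + |u − n|/s²`. [folklore] -/
theorem norm_phaseExpDeriv_le (s n γ u : ℝ) :
    ‖phaseExpDeriv s n γ u‖ ≤ |γ| + |u - n| / s ^ 2 := by
  unfold phaseExpDeriv
  refine (norm_sub_le _ _).trans ?_
  rw [Complex.norm_mul, Complex.norm_I, mul_one, Complex.norm_real, Complex.norm_real,
    Real.norm_eq_abs, Real.norm_eq_abs, abs_div, abs_of_nonneg (sq_nonneg s)]

/-- `G` is continuous. [folklore] -/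
theorem continuous_gaussPhase (s n γ : ℝ) : Continuous (gaussPhase s n γ) := by
  unfold gaussPhase phaseExp; fun_prop

/-- `φ'` is continuous. [folklore] -/
theorem continuous_phaseExpDeriv (s n γ : ℝ) : Continuous (phaseExpDeriv s n γ) := by
  unfold phaseExpDeriv; fun_prop

/-- `G(log m) = g(log m − n) · m^{iγ}` for `m ≥ 1`. [folklore] -/
theorem gaussPhase_log_natCast (s n γ : ℝ) {m : ℕ} (hm : m ≠ 0) :
    gaussPhase s n γ (Real.log m) =
      ((Real.exp (-((Real.log m - n) ^ 2 / (2 * s ^ 2))) : ℝ) : ℂ) * (m : ℂ) ^ (((γ : ℝ) : ℂ) * I) := by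
  have hm0 : (m : ℂ) ≠ 0 := Nat.cast_ne_zero.2 hm
  rw [Complex.cpow_def_of_ne_zero hm0, ← Complex.natCast_log, Complex.ofReal_exp, ← Complex.exp_add,
    gaussPhase, phaseExp]
  congr 1
  push_cast
  ring


/-! ## First-order Euler–Maclaurin: `‖∑_{m=2}^{M} F(m) − ∫_1^M F‖ ≤ ∫_1^M ‖F'‖` -/

/-- One unit cell: if `F` has the continuous derivative `F'` on `[a, a+1]`, then
`‖F(a+1) − ∫_a^{a+1} F‖ ≤ ∫_a^{a+1} ‖F'‖`. [folklore] -/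
theorem norm_sub_integral_unit_le {F F' : ℝ → ℂ} {a : ℝ}
    (hF : ∀ x ∈ Icc a (a + 1), HasDerivAt F (F' x) x) (hF' : ContinuousOn F' (Icc a (a + 1))) :
    ‖F (a + 1) - ∫ x in a..(a + 1), F x‖ ≤ ∫ x in a..(a + 1), ‖F' x‖ := by
  have hab : a ≤ a + 1 := by linarith
  have hFc : ContinuousOn F (Icc a (a + 1)) := fun x hx ↦ (hF x hx).continuousAt.continuousWithinAt
  set K : ℝ := ∫ x in a..(a + 1), ‖F' x‖ with hK
  have hK0 : 0 ≤ K := intervalIntegral.integral_nonneg hab fun x _ ↦ norm_nonneg _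
  -- pointwise: `‖F(a+1) - F x‖ ≤ K`
  have hpt : ∀ x ∈ Icc a (a + 1), ‖F (a + 1) - F x‖ ≤ K := by
    intro x hx
    have hderiv : ∀ t ∈ uIcc x (a + 1), HasDerivAt F (F' t) t := by
      intro t ht
      rw [uIcc_of_le hx.2] at ht
      exact hF t ⟨hx.1.trans ht.1, ht.2⟩
    have hint : IntervalIntegrable F' volume x (a + 1) :=
      (hF'.mono (Icc_subset_Icc hx.1 le_rfl)).intervalIntegrable_of_Icc hx.2
    rw [← integral_eq_sub_of_hasDerivAt hderiv hint]
    calc ‖∫ t in x..(a + 1), F' t‖ ≤ ∫ t in x..(a + 1), ‖F' t‖ :=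
          intervalIntegral.norm_integral_le_integral_norm hx.2
      _ ≤ K := by
          rw [hK]
          exact intervalIntegral.integral_mono_interval hx.1 hx.2 le_rfl
            (Filter.Eventually.of_forall fun t ↦ norm_nonneg _)
            ((hF'.norm).intervalIntegrable_of_Icc hab)
  -- `F(a+1) - ∫ F = ∫ (F(a+1) - F x) dx`
  have hFi : IntervalIntegrable F volume a (a + 1) := hFc.intervalIntegrable_of_Icc hab
  have heq : F (a + 1) - ∫ x in a..(a + 1), F x = ∫ x in a..(a + 1), (F (a + 1) - F x) := by
    rw [intervalIntegral.integral_sub intervalIntegrable_const hFi, intervalIntegral.integral_const]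
    simp
  rw [heq]
  have h := intervalIntegral.norm_integral_le_of_norm_le_const (a := a) (b := a + 1)
    (f := fun x ↦ F (a + 1) - F x) (C := K) (fun x hx ↦ ?_)
  · simpa using h
  · rw [uIoc_of_le hab] at hx
    exact hpt x ⟨hx.1.le, hx.2⟩

/-- **First-order Euler–Maclaurin bound.** If `F` has the continuous derivative `F'` on `[1, ∞)`,
then `‖∑_{m=2}^{M} F(m) − ∫_1^M F‖ ≤ ∫_1^M ‖F'‖` for every natural `M ≥ 1`. [folklore] -/
theorem norm_sum_sub_integral_le {F F' : ℝ → ℂ}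
    (hF : ∀ x : ℝ, 1 ≤ x → HasDerivAt F (F' x) x) (hF' : ContinuousOn F' (Ici 1)) :
    ∀ M : ℕ, 1 ≤ M →
      ‖∑ m ∈ Finset.Icc 2 M, F m - ∫ x in (1 : ℝ)..M, F x‖ ≤ ∫ x in (1 : ℝ)..M, ‖F' x‖ := by
  have hFc : ContinuousOn F (Ici 1) := fun x hx ↦ (hF x hx).continuousAt.continuousWithinAt
  intro M hM
  induction M with
  | zero => omega
  | succ M ih =>
    rcases Nat.lt_or_ge M 1 with h0 | h1
    · interval_cases M
      simp
    have ih' := ih h1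
    have hM1 : (1 : ℝ) ≤ M := by exact_mod_cast h1
    have hcell := norm_sub_integral_unit_le (F := F) (F' := F') (a := (M : ℝ))
      (fun x hx ↦ hF x (hM1.trans hx.1)) (hF'.mono fun x hx ↦ hM1.trans hx.1)
    have hsum : ∑ m ∈ Finset.Icc 2 (M + 1), F m = ∑ m ∈ Finset.Icc 2 M, F m + F ((M : ℝ) + 1) := by
      rw [Finset.sum_Icc_succ_top (by omega)]
      push_cast
      ring
    have hi1 : IntervalIntegrable F volume 1 M :=
      (hFc.mono (fun x hx ↦ hx.1)).intervalIntegrable_of_Icc hM1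
    have hi2 : IntervalIntegrable F volume M ((M : ℝ) + 1) :=
      (hFc.mono (fun x hx ↦ hM1.trans hx.1)).intervalIntegrable_of_Icc (by linarith)
    have hi1' : IntervalIntegrable (fun x ↦ ‖F' x‖) volume 1 M :=
      ((hF'.mono (fun x hx ↦ hx.1)).norm).intervalIntegrable_of_Icc hM1
    have hi2' : IntervalIntegrable (fun x ↦ ‖F' x‖) volume M ((M : ℝ) + 1) :=
      ((hF'.mono (fun x hx ↦ hM1.trans hx.1)).norm).intervalIntegrable_of_Icc (by linarith)
    have hint : ∫ x in (1 : ℝ)..((M + 1 : ℕ) : ℝ), F x =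
        (∫ x in (1 : ℝ)..M, F x) + ∫ x in (M : ℝ)..((M : ℝ) + 1), F x := by
      push_cast
      rw [intervalIntegral.integral_add_adjacent_intervals hi1 hi2]
    have hint' : ∫ x in (1 : ℝ)..((M + 1 : ℕ) : ℝ), ‖F' x‖ =
        (∫ x in (1 : ℝ)..M, ‖F' x‖) + ∫ x in (M : ℝ)..((M : ℝ) + 1), ‖F' x‖ := by
      push_cast
      rw [intervalIntegral.integral_add_adjacent_intervals hi1' hi2']
    rw [hsum, hint, hint']
    calc ‖∑ m ∈ Finset.Icc 2 M, F m + F ((M : ℝ) + 1) -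
          ((∫ x in (1 : ℝ)..M, F x) + ∫ x in (M : ℝ)..((M : ℝ) + 1), F x)‖
        = ‖(∑ m ∈ Finset.Icc 2 M, F m - ∫ x in (1 : ℝ)..M, F x) +
            (F ((M : ℝ) + 1) - ∫ x in (M : ℝ)..((M : ℝ) + 1), F x)‖ := by ring_nf
      _ ≤ ‖∑ m ∈ Finset.Icc 2 M, F m - ∫ x in (1 : ℝ)..M, F x‖ +
            ‖F ((M : ℝ) + 1) - ∫ x in (M : ℝ)..((M : ℝ) + 1), F x‖ := norm_add_le _ _
      _ ≤ _ := add_le_add ih' hcell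

/-! ## The composite `F(x) = G(log x)` on `[1, ∞)` -/

/-- `d/dx G(log x) = x⁻¹ • (G(log x) φ'(log x))` for `x > 0`. [folklore] -/
theorem hasDerivAt_gaussPhase_log (s n γ : ℝ) {x : ℝ} (hx : 0 < x) :
    HasDerivAt (fun x : ℝ ↦ gaussPhase s n γ (Real.log x))
      (x⁻¹ • (gaussPhase s n γ (Real.log x) * phaseExpDeriv s n γ (Real.log x))) x :=
  (hasDerivAt_gaussPhase s n γ (Real.log x)).scomp x (Real.hasDerivAt_log hx.ne')

/-- The derivative integral after the substitution `u = log x`: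
`∫_1^M ‖x⁻¹ • (G φ')(log x)‖ dx = ∫_0^{log M} ‖G(u) φ'(u)‖ du` (`M ≥ 1`). [folklore] -/
theorem integral_norm_deriv_eq (s n γ : ℝ) {M : ℝ} (hM : 1 ≤ M) :
    ∫ x in (1 : ℝ)..M, ‖x⁻¹ • (gaussPhase s n γ (Real.log x) * phaseExpDeriv s n γ (Real.log x))‖ =
      ∫ u in (0 : ℝ)..Real.log M, ‖gaussPhase s n γ u * phaseExpDeriv s n γ u‖ := by
  have hIcc : uIcc (1 : ℝ) M = Icc 1 M := uIcc_of_le hM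
  have h1 : ∫ x in (1 : ℝ)..M, ‖x⁻¹ • (gaussPhase s n γ (Real.log x) * phaseExpDeriv s n γ (Real.log x))‖ =
      ∫ x in (1 : ℝ)..M, x⁻¹ • ((fun u ↦ ‖gaussPhase s n γ u * phaseExpDeriv s n γ u‖) ∘ Real.log) x := by
    refine intervalIntegral.integral_congr fun x hx ↦ ?_
    rw [hIcc] at hx
    have hx0 : 0 < x := by linarith [hx.1]
    simp only [Function.comp_apply, norm_smul, Real.norm_eq_abs, abs_of_pos (inv_pos.2 hx0), smul_eq_mul]
  rw [h1, intervalIntegral.integral_deriv_smul_comp' (f := Real.log) (f' := fun x ↦ x⁻¹)]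
  · rw [Real.log_one]
  · intro x hx
    rw [hIcc] at hx
    exact Real.hasDerivAt_log (by linarith [hx.1])
  · rw [hIcc]
    exact continuousOn_inv₀.mono fun x hx ↦ by
      rw [mem_compl_iff, mem_singleton_iff]; exact (by linarith [hx.1] : (0 : ℝ) < x).ne'
  · exact (((continuous_gaussPhase s n γ).mul (continuous_phaseExpDeriv s n γ)).norm).continuousOn

/-- Pointwise: `‖G(u) φ'(u)‖ ≤ |γ| e^{−(u−n)²/(2s²)} + s⁻¹ e^{−(u−n)²/(4s²)}` (`s > 0`; uses
`t ≤ 1 + t²/4 ≤ e^{t²/4}`). [folklore] -/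
theorem norm_gaussPhase_mul_deriv_le {s : ℝ} (hs : 0 < s) (n γ u : ℝ) :
    ‖gaussPhase s n γ u * phaseExpDeriv s n γ u‖ ≤
      |γ| * Real.exp (-((2 * s ^ 2)⁻¹) * (u - n) ^ 2) + s⁻¹ * Real.exp (-((4 * s ^ 2)⁻¹) * (u - n) ^ 2) := by
  rw [norm_mul, norm_gaussPhase]
  have hg0 : 0 < Real.exp (-((u - n) ^ 2 / (2 * s ^ 2))) := Real.exp_pos _
  have hφ := norm_phaseExpDeriv_le s n γ u
  have e1 : Real.exp (-((u - n) ^ 2 / (2 * s ^ 2))) = Real.exp (-((2 * s ^ 2)⁻¹) * (u - n) ^ 2) := by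
    congr 1; ring
  -- the second term: `g(v) |v|/s² ≤ s⁻¹ e^{-v²/(4s²)}`
  have hs2 : 0 < s ^ 2 := by positivity
  have key : Real.exp (-((u - n) ^ 2 / (2 * s ^ 2))) * (|u - n| / s ^ 2) ≤
      s⁻¹ * Real.exp (-((4 * s ^ 2)⁻¹) * (u - n) ^ 2) := by
    -- `|v|/s ≤ 1 + v²/(4s²) ≤ exp(v²/(4s²))`
    have h1 : |u - n| / s ≤ Real.exp ((u - n) ^ 2 / (4 * s ^ 2)) := by
      have ht : |u - n| / s ≤ (u - n) ^ 2 / (4 * s ^ 2) + 1 := by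
        rw [div_add_one (by positivity), div_le_div_iff₀ hs (by positivity)]
        have hsq : |u - n| ^ 2 = (u - n) ^ 2 := sq_abs _
        nlinarith [sq_nonneg (|u - n| - 2 * s), abs_nonneg (u - n)]
      exact ht.trans (Real.add_one_le_exp _)
    have e2 : s⁻¹ * Real.exp (-((4 * s ^ 2)⁻¹) * (u - n) ^ 2) =
        Real.exp (-((u - n) ^ 2 / (2 * s ^ 2))) * (Real.exp ((u - n) ^ 2 / (4 * s ^ 2)) / s) := by
      rw [mul_div_assoc', ← Real.exp_add]
      have : -((u - n) ^ 2 / (2 * s ^ 2)) + (u - n) ^ 2 / (4 * s ^ 2) = -((4 * s ^ 2)⁻¹) * (u - n) ^ 2 := by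
        field_simp; ring
      rw [this]; ring
    rw [e2]
    refine mul_le_mul_of_nonneg_left ?_ hg0.le
    have e3 : |u - n| / s ^ 2 = |u - n| / s / s := by
      field_simp
    rw [e3]
    exact div_le_div_of_nonneg_right h1 hs.le
  calc Real.exp (-((u - n) ^ 2 / (2 * s ^ 2))) * ‖phaseExpDeriv s n γ u‖
      ≤ Real.exp (-((u - n) ^ 2 / (2 * s ^ 2))) * (|γ| + |u - n| / s ^ 2) :=
        mul_le_mul_of_nonneg_left hφ hg0.le
    _ = |γ| * Real.exp (-((u - n) ^ 2 / (2 * s ^ 2))) +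
          Real.exp (-((u - n) ^ 2 / (2 * s ^ 2))) * (|u - n| / s ^ 2) := by ring
    _ ≤ _ := by rw [← e1]; exact add_le_add le_rfl key

/-- `∫_0^{log M} ‖G φ'‖ ≤ |γ| √(2π s²) + s⁻¹ √(4π s²)` (`s > 0`, `M ≥ 1`): the two Gaussian
integrals over `ℝ`. [folklore] -/
theorem integral_norm_deriv_le {s : ℝ} (hs : 0 < s) (n γ : ℝ) {M : ℝ} (hM : 1 ≤ M) :
    ∫ u in (0 : ℝ)..Real.log M, ‖gaussPhase s n γ u * phaseExpDeriv s n γ u‖ ≤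
      |γ| * Real.sqrt (π / (2 * s ^ 2)⁻¹) + s⁻¹ * Real.sqrt (π / (4 * s ^ 2)⁻¹) := by
  have hlog : 0 ≤ Real.log M := Real.log_nonneg hM
  have hb1 : 0 < (2 * s ^ 2)⁻¹ := by positivity
  have hb2 : 0 < (4 * s ^ 2)⁻¹ := by positivity
  set H : ℝ → ℝ := fun u ↦ |γ| * Real.exp (-((2 * s ^ 2)⁻¹) * (u - n) ^ 2) +
    s⁻¹ * Real.exp (-((4 * s ^ 2)⁻¹) * (u - n) ^ 2) with hH
  have hH0 : ∀ u, 0 ≤ H u := fun u ↦ by positivity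
  have hI1 : Integrable fun u : ℝ ↦ Real.exp (-((2 * s ^ 2)⁻¹) * (u - n) ^ 2) :=
    (integrable_exp_neg_mul_sq hb1).comp_sub_right n
  have hI2 : Integrable fun u : ℝ ↦ Real.exp (-((4 * s ^ 2)⁻¹) * (u - n) ^ 2) :=
    (integrable_exp_neg_mul_sq hb2).comp_sub_right n
  have hHi : Integrable H := (hI1.const_mul _).add (hI2.const_mul _)
  have hcont : Continuous fun u ↦ ‖gaussPhase s n γ u * phaseExpDeriv s n γ u‖ :=
    ((continuous_gaussPhase s n γ).mul (continuous_phaseExpDeriv s n γ)).norm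
  calc ∫ u in (0 : ℝ)..Real.log M, ‖gaussPhase s n γ u * phaseExpDeriv s n γ u‖
      ≤ ∫ u in (0 : ℝ)..Real.log M, H u :=
        intervalIntegral.integral_mono_on hlog (hcont.intervalIntegrable _ _)
          (hHi.intervalIntegrable) fun u _ ↦ norm_gaussPhase_mul_deriv_le hs n γ u
    _ ≤ ∫ u, H u := by
        rw [intervalIntegral.integral_of_le hlog]
        exact setIntegral_le_integral hHi (Filter.Eventually.of_forall hH0)
    _ = |γ| * Real.sqrt (π / (2 * s ^ 2)⁻¹) + s⁻¹ * Real.sqrt (π / (4 * s ^ 2)⁻¹) := by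
        rw [hH, integral_add (hI1.const_mul _) (hI2.const_mul _), MeasureTheory.integral_const_mul,
          MeasureTheory.integral_const_mul]
        have e1 : ∫ u : ℝ, Real.exp (-((2 * s ^ 2)⁻¹) * (u - n) ^ 2) = Real.sqrt (π / (2 * s ^ 2)⁻¹) := by
          rw [integral_sub_right_eq_self (fun u ↦ Real.exp (-((2 * s ^ 2)⁻¹) * u ^ 2)) n]
          exact integral_gaussian _
        have e2 : ∫ u : ℝ, Real.exp (-((4 * s ^ 2)⁻¹) * (u - n) ^ 2) = Real.sqrt (π / (4 * s ^ 2)⁻¹) := by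
          rw [integral_sub_right_eq_self (fun u ↦ Real.exp (-((4 * s ^ 2)⁻¹) * u ^ 2)) n]
          exact integral_gaussian _
        rw [e1, e2]

end Summit.RiemannHypothesis.RiemannHypothesis.Theorems.EtaLeadingQuarter.LockingEngine

end
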